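import Summits.Ventures.PercRepro.RankLevelSetLevelSixHeavyCellSq37T
import Summits.Ventures.PercRepro.RankLevelSetLevelSixArithHeavySq37TA
import Summits.Ventures.PercRepro.RankLevelSetLevelSixArithHeavySq37TB
import Summits.Ventures.PercRepro.RankLevelSetLevelSixArithHeavySq37TC
import Summits.Ventures.PercRepro.RankLevelSetLevelSixArithHeavySq37TD
import Summits.Ventures.PercRepro.RankLevelSetLevelSixArithHeavySq37TE
import Summits.Ventures.PercRepro.RankLevelSetLevelSixArithHeavySq37TF
import Summits.Ventures.PercRepro.RankLevelSetLevelSixArithHeavySq37TG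
import Summits.Ventures.PercRepro.RankLevelSetLevelSixArithHeavySq37TH
import Summits.Ventures.PercRepro.RankLevelSetLevelSixArithHeavySq37TI
import Summits.Ventures.PercRepro.S3SixWindow
import Summits.Ventures.PercRepro.RankLevelSetCoreSixLowSelf
import Summits.Ventures.PercRepro.RankLevelSetLevelFivePart

/-!
# PercRepro — THEOREM C₆ ON THE FLAT BOUNDS `f(6) ≤ 39`, `f(5) ≤ 19`, LEMMA T⁺⁺⁺, THE 4-CIRCUIT TABLE, THE FLAT-COUNT TAIL AND
THE UNIQUE HEAVY FLAT: LEVEL `5` AT `36` ⇒ C-025 AT LEVEL `6` FOR EVERY `p ≥ 37`, AND `c025_six_large_thirty_seven (37 ≤ p) : RLS M p 6`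
UNCONDITIONAL (p8 g3, S3)

`proofs/SUBCLAIM-S3-p8.md` §3m. The 38 chain of §3l (`c025_six_large_thirty_eight`) with p1's LEMMA T⁺⁺⁺ (`s₃ ≤ (d² − 3d + 6)/2`,
`S1.ncard_triangles_le_of_nullity_sharp`, S1TrianglePlusSharp) for `s₃` and p1's 4-circuit table `s₄ ≤ fourCircuitBound d`
(`S1.ncard_fourCircuits_le_fourCircuitBound`, S1CoreFourCircuitSum; `170` at `d = 8`) in place of the closed form — the cell `d = 8`
that stops the 38 chain at `37` closes with `0.6 %` to spare; the levers otherwise as in §3k: THE UNIQUE HEAVY FLAT (RankLevelSetDepCountHeavyU: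
when `2ν₁ ≥ d + 15` two heavy rank-`6` flats would meet in a rank-`≤ 5` set of nullity `> 14`, so `|UG| ≤ min(39, 6 + d)` in place
of the union bound `6 + (j + 1)d − jν₁` — `2^{39}` against `2^{55}` at `(39, 41)`); the other levers as in §3i: p1's LEMMA T⁺⁺
(`s₃ ≤ (d² − 3d + 8)/2`, S1TrianglePlusPlus) and the FLAT-COUNT TAIL (the rank-`≤ 6` sets `≤ Σ_{j ≤ 19} C(n, j) +
2^{33}·Σ_{j ≤ 6} C(n, j)`, coranks 23 … 51). Every core cell `(p, 7 ≤ d ≤ 50)` at `p ≥ 37` by the split cell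
`c025_core_six_heavy_cell_sq39u` (the unique flat from `d = 30`; no heavy-free cell is needed), with the per-corank parameters
of RankLevelSetLevelSixArithHeavySq37TA … I (`c025_core_six_bounded_corank_heavy_sq37t`); the cells `d ≥ 52` by `c025_core_six_thirtynine_thirtyseven'`
(`37 ≤ p`, RankLevelSetCoreSixLowSelf: the corank key at `37` holds from `n₀ = 89 = p + 52`, so the cell `(37, 51)` is a bounded-corank cell here); level `5` for `p ≥ 36` gives level `6` for `p ≥ 37` (`c025_six_of_five_heavy_sq37t`: rank `37` by
`rls_six_at_of_core`, ranks `≥ 38` by `rls_succ_large`). On p7's `c025_five_large_part33 (33 ≤ p)` (RankLevelSetLevelFivePart)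
this is **`c025_six_large_thirty_seven (37 ≤ p)`**, unconditional over the tree. At `36` the cells `d = 8, 9, 12` fail (the `s₃` bound: T⁺⁺⁺'s `23 · 30 · 57` against the true caps —
p3's lane). Axioms: standard.
-/

open scoped Matroid

namespace PercRepro

namespace ThmN

open Set

variable {α : Type}

/-- **The `e`-free core at level `6`, corank `7 ≤ d ≤ 51`, rank `p ≥ 37`** (flat bounds `39 / 19`, LEMMA T⁺⁺, square
multiplicity, rational tails in the nullity-cap or the flat-count form, the unique heavy flat from `d = 30`, LEMMA T⁺⁺⁺ and the 4-circuit table). -/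
theorem c025_core_six_bounded_corank_heavy_sq37t (M : Matroid α) [M.Finite] (p d : ℕ) (hp : 37 ≤ p) (hd7 : 7 ≤ d)
    (hd51 : d ≤ 51) (hR : M.eRank = (p : ℕ∞)) (hn : M.E.ncard = p + d)
    (hfree : ∀ e ∈ M.E, ∃ A ⊆ M.E \ {e}, e ∉ M.closure A ∧ e ∉ M.closure ((M.E \ {e}) \ A)) :
    RLS M p 6 := by
  interval_cases d
  · exact c025_core_six_heavy_cell_sq37t M p 7 7 1 1 13 12 0 209091 1000 13 118
      (by norm_num) (by norm_num) (by norm_num) (by norm_num) (by norm_num) (by norm_num) (by norm_num)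
      (by norm_num [cnull]) (by norm_num [cnull]) (Or.inl (by norm_num)) (Or.inl (by norm_num)) (Or.inl (by norm_num)) (by norm_num) (by norm_num) (by norm_num) (by decide)
      (Or.inl (tail_six_heavy_sq37T_7 (p + 7) (by omega))) hR hn hfree (level_six_poly_heavy_sq37T_7 p hp)
  · exact c025_core_six_heavy_cell_sq37t M p 8 7 2 1 16 14 0 124148 1000 14 170
      (by norm_num) (by norm_num) (by norm_num) (by norm_num) (by norm_num) (by norm_num) (by norm_num)
      (by norm_num [cnull]) (by norm_num [cnull]) (Or.inl (by norm_num)) (Or.inl (by norm_num)) (Or.inl (by norm_num)) (by norm_num) (by norm_num) (by norm_num) (by decide)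
      (Or.inl (tail_six_heavy_sq37T_8 (p + 8) (by omega))) hR hn hfree (level_six_poly_heavy_sq37T_8 p hp)
  · exact c025_core_six_heavy_cell_sq37t M p 9 7 2 1 19 16 0 77110 1000 15 235
      (by norm_num) (by norm_num) (by norm_num) (by norm_num) (by norm_num) (by norm_num) (by norm_num)
      (by norm_num [cnull]) (by norm_num [cnull]) (Or.inl (by norm_num)) (Or.inl (by norm_num)) (Or.inl (by norm_num)) (by norm_num) (by norm_num) (by norm_num) (by decide)
      (Or.inl (tail_six_heavy_sq37T_9 (p + 9) (by omega))) hR hn hfree (level_six_poly_heavy_sq37T_9 p hp)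
  · exact c025_core_six_heavy_cell_sq37t M p 10 7 2 1 22 18 0 49894 1000 16 315
      (by norm_num) (by norm_num) (by norm_num) (by norm_num) (by norm_num) (by norm_num) (by norm_num)
      (by norm_num [cnull]) (by norm_num [cnull]) (Or.inl (by norm_num)) (Or.inl (by norm_num)) (Or.inl (by norm_num)) (by norm_num) (by norm_num) (by norm_num) (by decide)
      (Or.inl (tail_six_heavy_sq37T_10 (p + 10) (by omega))) hR hn hfree (level_six_poly_heavy_sq37T_10 p hp)
  · exact c025_core_six_heavy_cell_sq37t M p 11 8 2 1 23 19 0 33508 1000 17 411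
      (by norm_num) (by norm_num) (by norm_num) (by norm_num) (by norm_num) (by norm_num) (by norm_num)
      (by norm_num [cnull]) (by norm_num [cnull]) (Or.inl (by norm_num)) (Or.inl (by norm_num)) (Or.inl (by norm_num)) (by norm_num) (by norm_num) (by norm_num) (by decide)
      (Or.inl (tail_six_heavy_sq37T_11 (p + 11) (by omega))) hR hn hfree (level_six_poly_heavy_sq37T_11 p hp)
  · exact c025_core_six_heavy_cell_sq37t M p 12 9 2 1 24 20 0 23282 1000 18 525
      (by norm_num) (by norm_num) (by norm_num) (by norm_num) (by norm_num) (by norm_num) (by norm_num)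
      (by norm_num [cnull]) (by norm_num [cnull]) (Or.inl (by norm_num)) (Or.inl (by norm_num)) (Or.inl (by norm_num)) (by norm_num) (by norm_num) (by norm_num) (by decide)
      (Or.inl (tail_six_heavy_sq37T_12 (p + 12) (by omega))) hR hn hfree (level_six_poly_heavy_sq37T_12 p hp)
  · exact c025_core_six_heavy_cell_sq37t M p 13 10 1 1 22 18 0 16686 1000 19 658
      (by norm_num) (by norm_num) (by norm_num) (by norm_num) (by norm_num) (by norm_num) (by norm_num)
      (by norm_num [cnull]) (by norm_num [cnull]) (Or.inl (by norm_num)) (Or.inr (Or.inl ⟨by norm_num, by norm_num⟩)) (Or.inl (by norm_num)) (by norm_num) (by norm_num) (by norm_num) (by decide)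
      (Or.inl (tail_six_heavy_sq37T_13 (p + 13) (by omega))) hR hn hfree (level_six_poly_heavy_sq37T_13 p hp)
  · exact c025_core_six_heavy_cell_sq37t M p 14 11 1 1 23 19 0 12303 1000 20 812
      (by norm_num) (by norm_num) (by norm_num) (by norm_num) (by norm_num) (by norm_num) (by norm_num)
      (by norm_num [cnull]) (by norm_num [cnull]) (Or.inl (by norm_num)) (Or.inr (Or.inl ⟨by norm_num, by norm_num⟩)) (Or.inl (by norm_num)) (by norm_num) (by norm_num) (by norm_num) (by decide)
      (Or.inl (tail_six_heavy_sq37T_14 (p + 14) (by omega))) hR hn hfree (level_six_poly_heavy_sq37T_14 p hp)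
  · exact c025_core_six_heavy_cell_sq37t M p 15 11 1 1 25 19 0 9311 1000 21 988
      (by norm_num) (by norm_num) (by norm_num) (by norm_num) (by norm_num) (by norm_num) (by norm_num)
      (by norm_num [cnull]) (by norm_num [cnull]) (Or.inl (by norm_num)) (Or.inr (Or.inl ⟨by norm_num, by norm_num⟩)) (Or.inl (by norm_num)) (by norm_num) (by norm_num) (by norm_num) (by decide)
      (Or.inl (tail_six_heavy_sq37T_15 (p + 15) (by omega))) hR hn hfree (level_six_poly_heavy_sq37T_15 p hp)
  · exact c025_core_six_heavy_cell_sq37t M p 16 12 1 1 26 19 0 7215 1000 22 1188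
      (by norm_num) (by norm_num) (by norm_num) (by norm_num) (by norm_num) (by norm_num) (by norm_num)
      (by norm_num [cnull]) (by norm_num [cnull]) (Or.inl (by norm_num)) (Or.inr (Or.inl ⟨by norm_num, by norm_num⟩)) (Or.inl (by norm_num)) (by norm_num) (by norm_num) (by norm_num) (by decide)
      (Or.inl (tail_six_heavy_sq37T_16 (p + 16) (by omega))) hR hn hfree (level_six_poly_heavy_sq37T_16 p hp)
  · exact c025_core_six_heavy_cell_sq37t M p 17 12 1 1 28 19 0 5714 1000 23 1413
      (by norm_num) (by norm_num) (by norm_num) (by norm_num) (by norm_num) (by norm_num) (by norm_num)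
      (by norm_num [cnull]) (by norm_num [cnull]) (Or.inl (by norm_num)) (Or.inr (Or.inl ⟨by norm_num, by norm_num⟩)) (Or.inl (by norm_num)) (by norm_num) (by norm_num) (by norm_num) (by decide)
      (Or.inl (tail_six_heavy_sq37T_17 (p + 17) (by omega))) hR hn hfree (level_six_poly_heavy_sq37T_17 p hp)
  · exact c025_core_six_heavy_cell_sq37t M p 18 13 1 1 29 19 0 4616 1000 24 1665
      (by norm_num) (by norm_num) (by norm_num) (by norm_num) (by norm_num) (by norm_num) (by norm_num)
      (by norm_num [cnull]) (by norm_num [cnull]) (Or.inl (by norm_num)) (Or.inr (Or.inl ⟨by norm_num, by norm_num⟩)) (Or.inl (by norm_num)) (by norm_num) (by norm_num) (by norm_num) (by decide)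
      (Or.inl (tail_six_heavy_sq37T_18 (p + 18) (by omega))) hR hn hfree (level_six_poly_heavy_sq37T_18 p hp)
  · exact c025_core_six_heavy_cell_sq37t M p 19 13 1 1 31 19 0 3797 1000 25 1945
      (by norm_num) (by norm_num) (by norm_num) (by norm_num) (by norm_num) (by norm_num) (by norm_num)
      (by norm_num [cnull]) (by norm_num [cnull]) (Or.inl (by norm_num)) (Or.inr (Or.inl ⟨by norm_num, by norm_num⟩)) (Or.inl (by norm_num)) (by norm_num) (by norm_num) (by norm_num) (by decide)
      (Or.inl (tail_six_heavy_sq37T_19 (p + 19) (by omega))) hR hn hfree (level_six_poly_heavy_sq37T_19 p hp)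
  · exact c025_core_six_heavy_cell_sq37t M p 20 14 1 1 32 19 0 3175 1000 26 2255
      (by norm_num) (by norm_num) (by norm_num) (by norm_num) (by norm_num) (by norm_num) (by norm_num)
      (by norm_num [cnull]) (by norm_num [cnull]) (Or.inl (by norm_num)) (Or.inr (Or.inl ⟨by norm_num, by norm_num⟩)) (Or.inl (by norm_num)) (by norm_num) (by norm_num) (by norm_num) (by decide)
      (Or.inl (tail_six_heavy_sq37T_20 (p + 20) (by omega))) hR hn hfree (level_six_poly_heavy_sq37T_20 p hp)
  · exact c025_core_six_heavy_cell_sq37t M p 21 14 1 1 34 19 0 2695 1000 27 2596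
      (by norm_num) (by norm_num) (by norm_num) (by norm_num) (by norm_num) (by norm_num) (by norm_num)
      (by norm_num [cnull]) (by norm_num [cnull]) (Or.inl (by norm_num)) (Or.inr (Or.inl ⟨by norm_num, by norm_num⟩)) (Or.inl (by norm_num)) (by norm_num) (by norm_num) (by norm_num) (by decide)
      (Or.inl (tail_six_heavy_sq37T_21 (p + 21) (by omega))) hR hn hfree (level_six_poly_heavy_sq37T_21 p hp)
  · exact c025_core_six_heavy_cell_sq37t M p 22 15 1 1 35 0 0 2319 1000 28 2970
      (by norm_num) (by norm_num) (by norm_num) (by norm_num) (by norm_num) (by norm_num) (by norm_num)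
      (by norm_num [cnull]) (by norm_num [cnull]) (Or.inl (by norm_num)) (Or.inr (Or.inr (by norm_num))) (Or.inl (by norm_num)) (by norm_num) (by norm_num) (by norm_num) (by decide)
      (Or.inl (tail_six_heavy_sq37T_22 (p + 22) (by omega))) hR hn hfree (level_six_poly_heavy_sq37T_22 p hp)
  · exact c025_core_six_heavy_cell_sq37t M p 23 15 1 1 37 0 0 2141 1000 29 3378
      (by norm_num) (by norm_num) (by norm_num) (by norm_num) (by norm_num) (by norm_num) (by norm_num)
      (by norm_num [cnull]) (by norm_num [cnull]) (Or.inl (by norm_num)) (Or.inr (Or.inr (by norm_num))) (Or.inl (by norm_num)) (by norm_num) (by norm_num) (by norm_num) (by decide)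
      (Or.inr (tail_six_heavy_sq37T_23 (p + 23) (by omega))) hR hn hfree (level_six_poly_heavy_sq37T_23 p hp)
  · exact c025_core_six_heavy_cell_sq37t M p 24 17 1 1 37 0 1 3387 1000 30 3822
      (by norm_num) (by norm_num) (by norm_num) (by norm_num) (by norm_num) (by norm_num) (by norm_num)
      (by norm_num [cnull]) (by norm_num [cnull]) (Or.inl (by norm_num)) (Or.inr (Or.inr (by norm_num))) (Or.inr rfl) (by norm_num) (by norm_num) (by norm_num) (by decide)
      (Or.inr (tail_six_heavy_sq37T_24 (p + 24) (by omega))) hR hn hfree (level_six_poly_heavy_sq37T_24 p hp)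
  · exact c025_core_six_heavy_cell_sq37t M p 25 18 1 1 38 0 1 4757 1000 31 4303
      (by norm_num) (by norm_num) (by norm_num) (by norm_num) (by norm_num) (by norm_num) (by norm_num)
      (by norm_num [cnull]) (by norm_num [cnull]) (Or.inl (by norm_num)) (Or.inr (Or.inr (by norm_num))) (Or.inr rfl) (by norm_num) (by norm_num) (by norm_num) (by decide)
      (Or.inr (tail_six_heavy_sq37T_25 (p + 25) (by omega))) hR hn hfree (level_six_poly_heavy_sq37T_25 p hp)
  · exact c025_core_six_heavy_cell_sq37t M p 26 19 1 1 39 0 1 5707 1000 32 4823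
      (by norm_num) (by norm_num) (by norm_num) (by norm_num) (by norm_num) (by norm_num) (by norm_num)
      (by norm_num [cnull]) (by norm_num [cnull]) (Or.inl (by norm_num)) (Or.inr (Or.inr (by norm_num))) (Or.inr rfl) (by norm_num) (by norm_num) (by norm_num) (by decide)
      (Or.inr (tail_six_heavy_sq37T_26 (p + 26) (by omega))) hR hn hfree (level_six_poly_heavy_sq37T_26 p hp)
  · exact c025_core_six_heavy_cell_sq37t M p 27 19 1 1 41 0 1 5890 1000 33 5383
      (by norm_num) (by norm_num) (by norm_num) (by norm_num) (by norm_num) (by norm_num) (by norm_num)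
      (by norm_num [cnull]) (by norm_num [cnull]) (Or.inl (by norm_num)) (Or.inr (Or.inr (by norm_num))) (Or.inr rfl) (by norm_num) (by norm_num) (by norm_num) (by decide)
      (Or.inr (tail_six_heavy_sq37T_27 (p + 27) (by omega))) hR hn hfree (level_six_poly_heavy_sq37T_27 p hp)
  · exact c025_core_six_heavy_cell_sq37t M p 28 20 1 1 42 0 1 5482 1000 34 5985
      (by norm_num) (by norm_num) (by norm_num) (by norm_num) (by norm_num) (by norm_num) (by norm_num)
      (by norm_num [cnull]) (by norm_num [cnull]) (Or.inl (by norm_num)) (Or.inr (Or.inr (by norm_num))) (Or.inr rfl) (by norm_num) (by norm_num) (by norm_num) (by decide)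
      (Or.inr (tail_six_heavy_sq37T_28 (p + 28) (by omega))) hR hn hfree (level_six_poly_heavy_sq37T_28 p hp)
  · exact c025_core_six_heavy_cell_sq37t M p 29 22 1 1 35 0 1 4840 1000 35 6630
      (by norm_num) (by norm_num) (by norm_num) (by norm_num) (by norm_num) (by norm_num) (by norm_num)
      (by norm_num [cnull]) (by norm_num [cnull]) (Or.inr ⟨by norm_num, by norm_num⟩) (Or.inr (Or.inr (by norm_num))) (Or.inr rfl) (by norm_num) (by norm_num) (by norm_num) (by decide)
      (Or.inr (tail_six_heavy_sq37T_29 (p + 29) (by omega))) hR hn hfree (level_six_poly_heavy_sq37T_29 p hp)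
  · exact c025_core_six_heavy_cell_sq37t M p 30 23 1 1 36 0 1 4191 1000 36 7320
      (by norm_num) (by norm_num) (by norm_num) (by norm_num) (by norm_num) (by norm_num) (by norm_num)
      (by norm_num [cnull]) (by norm_num [cnull]) (Or.inr ⟨by norm_num, by norm_num⟩) (Or.inr (Or.inr (by norm_num))) (Or.inr rfl) (by norm_num) (by norm_num) (by norm_num) (by decide)
      (Or.inr (tail_six_heavy_sq37T_30 (p + 30) (by omega))) hR hn hfree (level_six_poly_heavy_sq37T_30 p hp)
  · exact c025_core_six_heavy_cell_sq37t M p 31 23 1 1 37 0 1 3623 1000 37 8056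
      (by norm_num) (by norm_num) (by norm_num) (by norm_num) (by norm_num) (by norm_num) (by norm_num)
      (by norm_num [cnull]) (by norm_num [cnull]) (Or.inr ⟨by norm_num, by norm_num⟩) (Or.inr (Or.inr (by norm_num))) (Or.inr rfl) (by norm_num) (by norm_num) (by norm_num) (by decide)
      (Or.inr (tail_six_heavy_sq37T_31 (p + 31) (by omega))) hR hn hfree (level_six_poly_heavy_sq37T_31 p hp)
  · exact c025_core_six_heavy_cell_sq37t M p 32 24 1 1 38 0 1 3151 1000 38 8840
      (by norm_num) (by norm_num) (by norm_num) (by norm_num) (by norm_num) (by norm_num) (by norm_num)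
      (by norm_num [cnull]) (by norm_num [cnull]) (Or.inr ⟨by norm_num, by norm_num⟩) (Or.inr (Or.inr (by norm_num))) (Or.inr rfl) (by norm_num) (by norm_num) (by norm_num) (by decide)
      (Or.inr (tail_six_heavy_sq37T_32 (p + 32) (by omega))) hR hn hfree (level_six_poly_heavy_sq37T_32 p hp)
  · exact c025_core_six_heavy_cell_sq37t M p 33 24 1 1 39 0 1 2768 1000 39 9673
      (by norm_num) (by norm_num) (by norm_num) (by norm_num) (by norm_num) (by norm_num) (by norm_num)
      (by norm_num [cnull]) (by norm_num [cnull]) (Or.inr ⟨by norm_num, by norm_num⟩) (Or.inr (Or.inr (by norm_num))) (Or.inr rfl) (by norm_num) (by norm_num) (by norm_num) (by decide)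
      (Or.inr (tail_six_heavy_sq37T_33 (p + 33) (by omega))) hR hn hfree (level_six_poly_heavy_sq37T_33 p hp)
  · exact c025_core_six_heavy_cell_sq37t M p 34 25 1 1 39 0 1 2457 1000 39 10557
      (by norm_num) (by norm_num) (by norm_num) (by norm_num) (by norm_num) (by norm_num) (by norm_num)
      (by norm_num [cnull]) (by norm_num [cnull]) (Or.inr ⟨by norm_num, by norm_num⟩) (Or.inr (Or.inr (by norm_num))) (Or.inr rfl) (by norm_num) (by norm_num) (by norm_num) (by decide)
      (Or.inr (tail_six_heavy_sq37T_34 (p + 34) (by omega))) hR hn hfree (level_six_poly_heavy_sq37T_34 p hp)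
  · exact c025_core_six_heavy_cell_sq37t M p 35 25 1 1 39 0 1 2205 1000 39 11493
      (by norm_num) (by norm_num) (by norm_num) (by norm_num) (by norm_num) (by norm_num) (by norm_num)
      (by norm_num [cnull]) (by norm_num [cnull]) (Or.inr ⟨by norm_num, by norm_num⟩) (Or.inr (Or.inr (by norm_num))) (Or.inr rfl) (by norm_num) (by norm_num) (by norm_num) (by decide)
      (Or.inr (tail_six_heavy_sq37T_35 (p + 35) (by omega))) hR hn hfree (level_six_poly_heavy_sq37T_35 p hp)
  · exact c025_core_six_heavy_cell_sq37t M p 36 26 1 1 39 0 1 1999 1000 39 12483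
      (by norm_num) (by norm_num) (by norm_num) (by norm_num) (by norm_num) (by norm_num) (by norm_num)
      (by norm_num [cnull]) (by norm_num [cnull]) (Or.inr ⟨by norm_num, by norm_num⟩) (Or.inr (Or.inr (by norm_num))) (Or.inr rfl) (by norm_num) (by norm_num) (by norm_num) (by decide)
      (Or.inr (tail_six_heavy_sq37T_36 (p + 36) (by omega))) hR hn hfree (level_six_poly_heavy_sq37T_36 p hp)
  · exact c025_core_six_heavy_cell_sq37t M p 37 26 1 1 39 0 1 1830 1000 39 13528
      (by norm_num) (by norm_num) (by norm_num) (by norm_num) (by norm_num) (by norm_num) (by norm_num)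
      (by norm_num [cnull]) (by norm_num [cnull]) (Or.inr ⟨by norm_num, by norm_num⟩) (Or.inr (Or.inr (by norm_num))) (Or.inr rfl) (by norm_num) (by norm_num) (by norm_num) (by decide)
      (Or.inr (tail_six_heavy_sq37T_37 (p + 37) (by omega))) hR hn hfree (level_six_poly_heavy_sq37T_37 p hp)
  · exact c025_core_six_heavy_cell_sq37t M p 38 27 1 1 39 0 1 1691 1000 39 14630
      (by norm_num) (by norm_num) (by norm_num) (by norm_num) (by norm_num) (by norm_num) (by norm_num)
      (by norm_num [cnull]) (by norm_num [cnull]) (Or.inr ⟨by norm_num, by norm_num⟩) (Or.inr (Or.inr (by norm_num))) (Or.inr rfl) (by norm_num) (by norm_num) (by norm_num) (by decide)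
      (Or.inr (tail_six_heavy_sq37T_38 (p + 38) (by omega))) hR hn hfree (level_six_poly_heavy_sq37T_38 p hp)
  · exact c025_core_six_heavy_cell_sq37t M p 39 27 1 1 39 0 1 1575 1000 39 15790
      (by norm_num) (by norm_num) (by norm_num) (by norm_num) (by norm_num) (by norm_num) (by norm_num)
      (by norm_num [cnull]) (by norm_num [cnull]) (Or.inr ⟨by norm_num, by norm_num⟩) (Or.inr (Or.inr (by norm_num))) (Or.inr rfl) (by norm_num) (by norm_num) (by norm_num) (by decide)
      (Or.inr (tail_six_heavy_sq37T_39 (p + 39) (by omega))) hR hn hfree (level_six_poly_heavy_sq37T_39 p hp)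
  · exact c025_core_six_heavy_cell_sq37t M p 40 28 1 1 39 0 1 1480 1000 39 17010
      (by norm_num) (by norm_num) (by norm_num) (by norm_num) (by norm_num) (by norm_num) (by norm_num)
      (by norm_num [cnull]) (by norm_num [cnull]) (Or.inr ⟨by norm_num, by norm_num⟩) (Or.inr (Or.inr (by norm_num))) (Or.inr rfl) (by norm_num) (by norm_num) (by norm_num) (by decide)
      (Or.inr (tail_six_heavy_sq37T_40 (p + 40) (by omega))) hR hn hfree (level_six_poly_heavy_sq37T_40 p hp)
  · exact c025_core_six_heavy_cell_sq37t M p 41 28 1 1 39 0 1 1400 1000 39 18291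
      (by norm_num) (by norm_num) (by norm_num) (by norm_num) (by norm_num) (by norm_num) (by norm_num)
      (by norm_num [cnull]) (by norm_num [cnull]) (Or.inr ⟨by norm_num, by norm_num⟩) (Or.inr (Or.inr (by norm_num))) (Or.inr rfl) (by norm_num) (by norm_num) (by norm_num) (by decide)
      (Or.inr (tail_six_heavy_sq37T_41 (p + 41) (by omega))) hR hn hfree (level_six_poly_heavy_sq37T_41 p hp)
  · exact c025_core_six_heavy_cell_sq37t M p 42 29 1 1 39 0 1 1333 1000 39 19635
      (by norm_num) (by norm_num) (by norm_num) (by norm_num) (by norm_num) (by norm_num) (by norm_num)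
      (by norm_num [cnull]) (by norm_num [cnull]) (Or.inr ⟨by norm_num, by norm_num⟩) (Or.inr (Or.inr (by norm_num))) (Or.inr rfl) (by norm_num) (by norm_num) (by norm_num) (by decide)
      (Or.inr (tail_six_heavy_sq37T_42 (p + 42) (by omega))) hR hn hfree (level_six_poly_heavy_sq37T_42 p hp)
  · exact c025_core_six_heavy_cell_sq37t M p 43 29 1 1 39 0 1 1277 1000 39 21043
      (by norm_num) (by norm_num) (by norm_num) (by norm_num) (by norm_num) (by norm_num) (by norm_num)
      (by norm_num [cnull]) (by norm_num [cnull]) (Or.inr ⟨by norm_num, by norm_num⟩) (Or.inr (Or.inr (by norm_num))) (Or.inr rfl) (by norm_num) (by norm_num) (by norm_num) (by decide)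
      (Or.inr (tail_six_heavy_sq37T_43 (p + 43) (by omega))) hR hn hfree (level_six_poly_heavy_sq37T_43 p hp)
  · exact c025_core_six_heavy_cell_sq37t M p 44 30 1 1 39 0 1 1230 1000 39 22517
      (by norm_num) (by norm_num) (by norm_num) (by norm_num) (by norm_num) (by norm_num) (by norm_num)
      (by norm_num [cnull]) (by norm_num [cnull]) (Or.inr ⟨by norm_num, by norm_num⟩) (Or.inr (Or.inr (by norm_num))) (Or.inr rfl) (by norm_num) (by norm_num) (by norm_num) (by decide)
      (Or.inr (tail_six_heavy_sq37T_44 (p + 44) (by omega))) hR hn hfree (level_six_poly_heavy_sq37T_44 p hp)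
  · exact c025_core_six_heavy_cell_sq37t M p 45 30 1 1 39 0 1 1190 1000 39 24058
      (by norm_num) (by norm_num) (by norm_num) (by norm_num) (by norm_num) (by norm_num) (by norm_num)
      (by norm_num [cnull]) (by norm_num [cnull]) (Or.inr ⟨by norm_num, by norm_num⟩) (Or.inr (Or.inr (by norm_num))) (Or.inr rfl) (by norm_num) (by norm_num) (by norm_num) (by decide)
      (Or.inr (tail_six_heavy_sq37T_45 (p + 45) (by omega))) hR hn hfree (level_six_poly_heavy_sq37T_45 p hp)
  · exact c025_core_six_heavy_cell_sq37t M p 46 31 1 1 39 0 1 1157 1000 39 25668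
      (by norm_num) (by norm_num) (by norm_num) (by norm_num) (by norm_num) (by norm_num) (by norm_num)
      (by norm_num [cnull]) (by norm_num [cnull]) (Or.inr ⟨by norm_num, by norm_num⟩) (Or.inr (Or.inr (by norm_num))) (Or.inr rfl) (by norm_num) (by norm_num) (by norm_num) (by decide)
      (Or.inr (tail_six_heavy_sq37T_46 (p + 46) (by omega))) hR hn hfree (level_six_poly_heavy_sq37T_46 p hp)
  · exact c025_core_six_heavy_cell_sq37t M p 47 31 1 1 39 0 1 1129 1000 39 27348
      (by norm_num) (by norm_num) (by norm_num) (by norm_num) (by norm_num) (by norm_num) (by norm_num)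
      (by norm_num [cnull]) (by norm_num [cnull]) (Or.inr ⟨by norm_num, by norm_num⟩) (Or.inr (Or.inr (by norm_num))) (Or.inr rfl) (by norm_num) (by norm_num) (by norm_num) (by decide)
      (Or.inr (tail_six_heavy_sq37T_47 (p + 47) (by omega))) hR hn hfree (level_six_poly_heavy_sq37T_47 p hp)
  · exact c025_core_six_heavy_cell_sq37t M p 48 32 1 1 39 0 1 1106 1000 39 29100
      (by norm_num) (by norm_num) (by norm_num) (by norm_num) (by norm_num) (by norm_num) (by norm_num)
      (by norm_num [cnull]) (by norm_num [cnull]) (Or.inr ⟨by norm_num, by norm_num⟩) (Or.inr (Or.inr (by norm_num))) (Or.inr rfl) (by norm_num) (by norm_num) (by norm_num) (by decide)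
      (Or.inr (tail_six_heavy_sq37T_48 (p + 48) (by omega))) hR hn hfree (level_six_poly_heavy_sq37T_48 p hp)
  · exact c025_core_six_heavy_cell_sq37t M p 49 32 1 1 39 0 1 1087 1000 39 30925
      (by norm_num) (by norm_num) (by norm_num) (by norm_num) (by norm_num) (by norm_num) (by norm_num)
      (by norm_num [cnull]) (by norm_num [cnull]) (Or.inr ⟨by norm_num, by norm_num⟩) (Or.inr (Or.inr (by norm_num))) (Or.inr rfl) (by norm_num) (by norm_num) (by norm_num) (by decide)
      (Or.inr (tail_six_heavy_sq37T_49 (p + 49) (by omega))) hR hn hfree (level_six_poly_heavy_sq37T_49 p hp)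
  · exact c025_core_six_heavy_cell_sq37t M p 50 33 1 1 39 0 1 1071 1000 39 32825
      (by norm_num) (by norm_num) (by norm_num) (by norm_num) (by norm_num) (by norm_num) (by norm_num)
      (by norm_num [cnull]) (by norm_num [cnull]) (Or.inr ⟨by norm_num, by norm_num⟩) (Or.inr (Or.inr (by norm_num))) (Or.inr rfl) (by norm_num) (by norm_num) (by norm_num) (by decide)
      (Or.inr (tail_six_heavy_sq37T_50 (p + 50) (by omega))) hR hn hfree (level_six_poly_heavy_sq37T_50 p hp)
  · exact c025_core_six_heavy_cell_sq37t M p 51 33 1 1 39 0 1 1057 1000 39 34801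
      (by norm_num) (by norm_num) (by norm_num) (by norm_num) (by norm_num) (by norm_num) (by norm_num)
      (by norm_num [cnull]) (by norm_num [cnull]) (Or.inr ⟨by norm_num, by norm_num⟩) (Or.inr (Or.inr (by norm_num))) (Or.inr rfl) (by norm_num) (by norm_num) (by norm_num) (by decide)
      (Or.inr (tail_six_heavy_sq37T_51 (p + 51) (by omega))) hR hn hfree (level_six_poly_heavy_sq37T_51 p hp)

/-- **THEOREM C₆ ON THE FLAT BOUNDS `39 / 19`, LEMMA T⁺⁺⁺, THE 4-CIRCUIT TABLE, THE FLAT-COUNT TAIL AND THE UNIQUE HEAVY FLAT, GIVEN LEVEL `5`**: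
level `5` for all `p ≥ 36` implies level `6` for all `p ≥ 37`. -/
theorem c025_six_of_five_heavy_sq37t (h5 : ∀ (M : Matroid α) [M.Finite] (p : ℕ), 36 ≤ p → RLS M p 5) :
    ∀ (M : Matroid α) [M.Finite] (p : ℕ), 37 ≤ p → RLS M p 6 := by
  intro M _ p hp
  rcases Nat.lt_or_ge p 38 with hlt | hge
  · have hP : p = 37 := by omega
    subst hP
    refine rls_six_at_of_core 37 (by norm_num) (fun M _ => h5 M 36 (by norm_num)) ?_ M
    intro M _ d hd hR hn hfree
    rcases Nat.lt_or_ge d 52 with hd51 | hd52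
    · exact c025_core_six_bounded_corank_heavy_sq37t M 37 d (by norm_num) hd (by omega) hR hn hfree
    · exact c025_core_six_thirtynine_thirtyseven' M 37 (by norm_num) hR (by omega) hfree
  · refine rls_succ_large (α := α) 5 6 37 ?_ ?_ ?_ M p hge (by omega)
    · intro M' _ p' hP _
      exact h5 M' p' (by omega)
    · intro M' _ p' _ hn _
      rcases Nat.lt_or_ge M'.E.ncard (p' + 6) with h | h
      · exact RLS_of_ncard_lt M' h
      · exact RLS_of_ncard_eq M' (by omega)
    · intro M' _ p' hP hR hbig _ hfree
      rcases Nat.lt_or_ge M'.E.ncard (p' + 52) with h | h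
      · exact c025_core_six_bounded_corank_heavy_sq37t M' p' (M'.E.ncard - p') hP (by omega) (by omega) hR (by omega) hfree
      · exact c025_core_six_thirtynine_thirtyseven' M' p' (by omega) hR (by omega) hfree

/-- **C-025 AT LEVEL `6` FOR EVERY `p ≥ 37`, EVERY FINITE MATROID, UNCONDITIONAL** — `c025_six_of_five_heavy_sq37t` on
p7's level-`5` row `c025_five_large_part33 (33 ≤ p)`. -/
theorem c025_six_large_thirty_seven (M : Matroid α) [M.Finite] (p : ℕ) (hp : 37 ≤ p) : RLS M p 6 :=
  c025_six_of_five_heavy_sq37t (fun M _ p hp => c025_five_large_part33 M p (by omega)) M p hp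

/-- The same in the vocabulary of `C025`: the level-`6` frontier of the counting route is every `p ≥ 37`. -/
theorem c025_six_large_thirty_seven' (M : Matroid α) [M.Finite] (p : ℕ) (hp : 37 ≤ p) :
    phiK p 6 * ({A : Set α | A ⊆ M.E ∧ M.eRk A = (p : ℕ∞) ∧ M.eRk (M.E \ A) = (6 : ℕ∞)}.ncard : ℚ) ≤
      ({A : Set α | A ⊆ M.E ∧ (6 : ℕ∞) < M.eRk A ∧ M.eRk A < (p : ℕ∞)}.ncard : ℚ) :=
  c025_six_large_thirty_seven M p hp

end ThmN

end PercRepro
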